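import Summits.QuantumFields.GaugeBoot.BootstrapSpaceGroupReductionZd
import Summits.QuantumFields.GaugeBoot.SymmetricBootstrapConvergenceZd
import HarnessLib

/-!
# The space-group-reduced bootstrap on `ℤ^d` converges to the fully symmetric Gibbs states (gauge-boot, L1/L4 supplement)

HONEST FRAMING (cell `pub-gaugeboot`, page 1 of every file): the venture produces certified bounds
on lattice expectations at stated coupling, gauge group, dimension and torus size; NOT a mass gap,
NOT a continuum limit, NOT a string tension; NOT Yang–Mills-summit-bearing (barriers
`FixedCouplingUltralocality`, `PerturbativeInvisibility`). Structural; it certifies no number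
and says nothing about RATES.

## Content (`SU(N)` on `ℤ^d`, any real `β`; the orientation-preserving space group `S_d ⋉ ℤ^d`)

`SymmetricBootstrapConvergenceZd` did the translations; here the axis permutations are added
(`BootstrapSpaceGroupReductionZd.spaceSymLevelValuesZdSuN`):

* `isAxisPermInvariant_of_forall_poly` — invariance of a measure under the axis permutations
  `relabelConfig (edgePerm σ)` from invariance of its polynomial moments;
* ★★★ `spaceSymBootstrap_convergence_dlr_suN` — for every polynomial observable `P` and `ε > 0`
  there is a level `n` such that every value of the space-group-reduced level-`n` SDP lies within
  `ε` of `∫ P dμ` for some Gibbs state `μ` invariant under ALL translations AND ALL axis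
  permutations; ★★ `spaceSymLevelValuesZd_hausdorff_suN` (with soundness
  `dlr_integral_mem_spaceSymLevelValuesZd`: the reduced hierarchy converges to exactly the range
  of `P` over the fully symmetric phases);
* ★★ `exists_fullySymmetric_dlr_suN` — Gibbs states invariant under translations and axis
  permutations exist at every `β` (point-group average of the translation average of any Gibbs
  state, realised through the untruncated bootstrap).

What this is NOT: reflections (the full hyperoctahedral group); rates; symmetry breaking.

References: V. Kazakov, Z. Zheng, arXiv:2203.11360 §3.3; H.-O. Georgii, Gibbs Measures and Phase
Transitions (2011) Ch. 5. Folklore.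
-/

noncomputable section

open MeasureTheory Filter Topology NormedSpace
open Literature.MathematicalPhysics.QuantumFieldTheory (LatticeRep ymGibbsMeasures_nonempty)
open Literature.MathematicalPhysics.QuantumLattice

namespace Summit.QuantumFields.GaugeBoot

section ZdSuN

variable {d : ℕ} (N : ℕ) (β : ℝ)

/-- **Axis-permutation invariance of a measure from invariance of its polynomial moments.** -/
theorem isAxisPermInvariant_of_forall_poly
    {μ : Measure (LGConfig d (Matrix.specialUnitaryGroup (Fin N) ℂ))} [IsFiniteMeasure μ]
    (h : ∀ (σ : Equiv.Perm (Fin d)), ∀ a ∈ polyAlgebra (ι := ZdEdge d) (fundamentalLatticeRep N),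
      ∫ U, a (relabelCM (G := Matrix.specialUnitaryGroup (Fin N) ℂ) (edgePerm σ) U) ∂μ = ∫ U, a U ∂μ)
    (σ : Equiv.Perm (Fin d)) :
    μ.map (relabelConfig (edgePerm σ)) = μ := by
  refine eq_of_forall_integral_poly_eq (fundamentalLatticeRep N) _ _ fun a ha => ?_
  rw [integral_map_equiv]
  have he : ∀ U : LGConfig d (Matrix.specialUnitaryGroup (Fin N) ℂ),
      relabelConfig (edgePerm σ) U = relabelCM (G := Matrix.specialUnitaryGroup (Fin N) ℂ) (edgePerm σ⁻¹) U := fun U => by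
    rw [relabelCM_edgePerm_eq_relabelConfig, inv_inv]
  simp only [he]
  exact h σ⁻¹ a ha

/-- ★★★ **The space-group-reduced bootstrap on `ℤ^d` converges to the fully symmetric Gibbs states.**
`SU(N)`, any `d`, any real `β`: for every polynomial observable `P` and `ε > 0` there is a level
`n` such that every value of the level-`n` SDP reduced by translations AND axis permutations lies
within `ε` of `∫ P dμ` for some Gibbs state `μ` invariant under all translations and all axis
permutations. [folklore] -/
theorem spaceSymBootstrap_convergence_dlr_suN
    {P : C(LGConfig d (Matrix.specialUnitaryGroup (Fin N) ℂ), ℝ)}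
    (hP : P ∈ polyAlgebra (ι := ZdEdge d) (fundamentalLatticeRep N)) {ε : ℝ} (hε : 0 < ε) :
    ∃ n, ∀ t ∈ spaceSymLevelValuesZdSuN (d := d) N β n P,
      ∃ μ ∈ ymGibbsMeasures (d := d) (fundamentalRep (Fin N)) β,
        IsZdTranslationInvariant μ ∧ (∀ σ : Equiv.Perm (Fin d), μ.map (relabelConfig (edgePerm σ)) = μ) ∧
          |t - ∫ U, P U ∂μ| ≤ ε := by
  obtain ⟨n, hn⟩ := bootstrap_convergence_invariant (fundamentalLatticeRep N) (suExp_add N)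
    (X := fun X : SuGenerator N => (X : Matrix (Fin N) (Fin N) ℂ)) (rho_suExp N)
    (S := fun e => wilsonBoundaryAction (fundamentalRep (Fin N)) {e}) (β := β)
    (fun e => wilsonBoundaryAction_mem_polyFunctions (fundamentalLatticeRep N) {e})
    (fun n => wordTruncation (ι := ZdEdge d) (fundamentalLatticeRep N) n)
    (fun a ha => eventually_mem_wordTruncation (fundamentalLatticeRep N) ha)
    ((Set.range fun v : Fin d → ℤ => relabelCM (G := Matrix.specialUnitaryGroup (Fin N) ℂ) (edgeShift v)) ∪
      Set.range fun σ : Equiv.Perm (Fin d) => relabelCM (G := Matrix.specialUnitaryGroup (Fin N) ℂ) (edgePerm σ))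
    (by
      rintro R (⟨v, rfl⟩ | ⟨σ, rfl⟩) a ha
      · exact comp_relabelCM_mem_polyAlgebra (fundamentalLatticeRep N) _ ha
      · exact comp_relabelCM_mem_polyAlgebra (fundamentalLatticeRep N) _ ha)
    hP hε
  refine ⟨n, ?_⟩
  rintro t ⟨φ, hφ, hT, hperm, rfl⟩
  obtain ⟨ψ, hψ, hψinv, hclose⟩ := hn φ hφ (by
    rintro R (⟨v, rfl⟩ | ⟨σ, rfl⟩) a ha
    · exact hT v a (wordTruncation_mono _ (Nat.le_add_right n n) ha)
    · exact hperm σ a (wordTruncation_mono _ (Nat.le_add_right n n) ha))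
  obtain ⟨μ, hμ, hψμ⟩ := exists_dlr_of_bootstrap_suN N β hψ.1 hψ.2.1 hψ.2.2
  haveI := hμ.1
  have hmom : ∀ R, R ∈ ((Set.range fun v : Fin d → ℤ =>
        relabelCM (G := Matrix.specialUnitaryGroup (Fin N) ℂ) (edgeShift v)) ∪
      Set.range fun σ : Equiv.Perm (Fin d) => relabelCM (G := Matrix.specialUnitaryGroup (Fin N) ℂ) (edgePerm σ)) →
      ∀ a ∈ polyAlgebra (ι := ZdEdge d) (fundamentalLatticeRep N), ∫ U, a (R U) ∂μ = ∫ U, a U ∂μ := by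
    intro R hR a ha
    have hpoly : a.comp R ∈ polyAlgebra (ι := ZdEdge d) (fundamentalLatticeRep N) := by
      rcases hR with ⟨v, rfl⟩ | ⟨σ, rfl⟩
      · exact comp_relabelCM_mem_polyAlgebra (fundamentalLatticeRep N) _ ha
      · exact comp_relabelCM_mem_polyAlgebra (fundamentalLatticeRep N) _ ha
    have h2 := hψμ _ hpoly
    simp only [ContinuousMap.comp_apply] at h2
    rw [← h2, ← hψμ a ha]
    exact hψinv R hR a ha
  refine ⟨μ, hμ, isZdTranslationInvariant_of_forall_poly N (fun v a ha => hmom _ (Or.inl ⟨v, rfl⟩) a ha),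
    isAxisPermInvariant_of_forall_poly N (fun σ a ha => hmom _ (Or.inr ⟨σ, rfl⟩) a ha), ?_⟩
  rwa [hψμ P hP] at hclose

/-- ★★ **Hausdorff form**: for `n` large the space-group-reduced level-`n` values of `P` and the
expectations of `P` over the fully symmetric Gibbs states are within `ε`; every such expectation
IS a reduced value at every level. -/
theorem spaceSymLevelValuesZd_hausdorff_suN
    {P : C(LGConfig d (Matrix.specialUnitaryGroup (Fin N) ℂ), ℝ)}
    (hP : P ∈ polyAlgebra (ι := ZdEdge d) (fundamentalLatticeRep N)) {ε : ℝ} (hε : 0 < ε) :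
    ∃ n, (∀ t ∈ spaceSymLevelValuesZdSuN (d := d) N β n P,
        ∃ μ ∈ ymGibbsMeasures (d := d) (fundamentalRep (Fin N)) β,
          IsZdTranslationInvariant μ ∧ (∀ σ : Equiv.Perm (Fin d), μ.map (relabelConfig (edgePerm σ)) = μ) ∧
            |t - ∫ U, P U ∂μ| ≤ ε) ∧
      ∀ μ ∈ ymGibbsMeasures (d := d) (fundamentalRep (Fin N)) β, IsZdTranslationInvariant μ →
        (∀ σ : Equiv.Perm (Fin d), μ.map (relabelConfig (edgePerm σ)) = μ) →
          ∫ U, P U ∂μ ∈ spaceSymLevelValuesZdSuN (d := d) N β n P := by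
  obtain ⟨n, hn⟩ := spaceSymBootstrap_convergence_dlr_suN N β hP hε
  exact ⟨n, hn, fun μ hμ hT hperm => dlr_integral_mem_spaceSymLevelValuesZd N β n hμ hT hperm P⟩

/-- ★★ **Fully symmetric Gibbs states exist at every `β`** (`SU(N)` on `ℤ^d`): invariant under all
translations and all axis permutations. The point-group average of the expectation functional of a
translation-invariant Gibbs state is an untruncated bootstrap solution, translation invariant
because permutations normalise translations, realised by a DLR state. [folklore] -/
theorem exists_fullySymmetric_dlr_suN :
    ∃ μ ∈ ymGibbsMeasures (d := d) (fundamentalRep (Fin N)) β,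
      IsZdTranslationInvariant μ ∧ ∀ σ : Equiv.Perm (Fin d), μ.map (relabelConfig (edgePerm σ)) = μ := by
  obtain ⟨ν, hν, hνT⟩ := exists_translationInvariant_dlr_suN (d := d) N β
  haveI := hν.1
  set φ := expectationFunctional ν with hφdef
  have hφ : IsBootstrapFeasible (fundamentalLatticeRep N) (suExp N)
      (fun e => wilsonBoundaryAction (fundamentalRep (Fin N)) {e}) β
      (polyAlgebra (ι := ZdEdge d) (fundamentalLatticeRep N) : Set _) φ :=
    isBootstrapFeasible_dlr_suN N β hν subset_rfl
  set R : Equiv.Perm (Fin d) → C(LGConfig d (Matrix.specialUnitaryGroup (Fin N) ℂ),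
      LGConfig d (Matrix.specialUnitaryGroup (Fin N) ℂ)) :=
    fun σ => relabelCM (G := Matrix.specialUnitaryGroup (Fin N) ℂ) (edgePerm σ) with hRdef
  have hR : ∀ δ, ∃ g : Equiv.Perm (Fin d) ≃ Equiv.Perm (Fin d), ∀ γ, (R δ).comp (R γ) = R (g γ) :=
    fun δ => ⟨Equiv.mulRight δ, fun γ => by
      simp only [hRdef, Equiv.coe_mulRight]
      exact relabelCM_edgePerm_comp γ δ⟩
  have hfeas : ∀ σ, IsBootstrapFeasible (fundamentalLatticeRep N) (suExp N)
      (fun e => wilsonBoundaryAction (fundamentalRep (Fin N)) {e}) β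
      (polyAlgebra (ι := ZdEdge d) (fundamentalLatticeRep N) : Set _)
      (φ ∘ₗ (ContinuousMap.compRightAlgHom ℝ ℝ (R σ)).toLinearMap) := fun σ =>
    hφ.comp_relabel (fundamentalLatticeRep N) (edgePerm σ) (wilsonBoundaryAction_permCovariant_suN N σ)
      (fun v hv => comp_relabelCM_mem_polyAlgebra (fundamentalLatticeRep N) _ hv)
  have hψ := isBootstrapFeasible_avgFunctional (fundamentalLatticeRep N) R hfeas
  obtain ⟨μ, hμ, hψμ⟩ := exists_dlr_of_bootstrap_suN N β hψ.1 hψ.2.1 hψ.2.2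
  haveI := hμ.1
  -- translation invariance of `φ` on every observable
  have hφT : ∀ (v : Fin d → ℤ) (x : C(LGConfig d (Matrix.specialUnitaryGroup (Fin N) ℂ), ℝ)),
      φ (x.comp (relabelCM (G := Matrix.specialUnitaryGroup (Fin N) ℂ) (edgeShift v))) = φ x := fun v x => by
    rw [hφdef, expectationFunctional_apply, expectationFunctional_apply]
    have hmp : MeasurePreserving (configShift (G := Matrix.specialUnitaryGroup (Fin N) ℂ) (-v)) ν ν :=
      ⟨(configShift _).measurable, hνT (-v)⟩
    have h := hmp.integral_comp (configShift (-v)).measurableEmbedding (fun U => x U)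
    simp only [ContinuousMap.comp_apply, relabelCM_edgeShift_eq_configShift]
    exact h
  refine ⟨μ, hμ, isZdTranslationInvariant_of_forall_poly N (fun v a ha => ?_),
    isAxisPermInvariant_of_forall_poly N (fun σ a ha => ?_)⟩
  · have h2 := hψμ _ (comp_relabelCM_mem_polyAlgebra (fundamentalLatticeRep N) (edgeShift v) ha)
    simp only [ContinuousMap.comp_apply] at h2
    rw [← h2, ← hψμ a ha, avgFunctional_apply, avgFunctional_apply]
    congr 1
    refine Finset.sum_congr rfl fun σ _ => ?_
    have hc : (a.comp (relabelCM (G := Matrix.specialUnitaryGroup (Fin N) ℂ) (edgeShift v))).comp (R σ) =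
        (a.comp (R σ)).comp (relabelCM (G := Matrix.specialUnitaryGroup (Fin N) ℂ) (edgeShift (sitePerm σ v))) := by
      simp only [hRdef]
      rw [ContinuousMap.comp_assoc, ContinuousMap.comp_assoc, relabelCM_edgeShift_comp_edgePerm]
    rw [hc]
    exact hφT (sitePerm σ v) _
  · have h2 := hψμ _ (comp_relabelCM_mem_polyAlgebra (fundamentalLatticeRep N) (edgePerm σ) ha)
    simp only [ContinuousMap.comp_apply] at h2
    rw [← h2, ← hψμ a ha]
    exact avgFunctional_comp_eq R hR φ σ a

end ZdSuN

end Summit.QuantumFields.GaugeBoot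

end
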